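import Literature.NumberTheory.DiophantineGeometry.AbcDepthCensus

/-!
# A certified census of abc triples by 5-depth in boxes `c ≤ N` — the Chinese-remainder lattice walk

Upgrade of the enumeration checker of `AbcDepthCensus.lean`.  `checkCell` walks, for every depth
pattern `(A, B, C)`, the two members with the largest moduli (`loopBest`, cost `≈ N²/(2·M₁M₂)`); here
`loopCRT` iterates ONLY the member with the largest modulus and runs the second member over the exact
residue class forced by the other two moduli (Chinese remainder, `Nat.chineseRemainder`), the third being
determined — cost `≈ N/M₁ +` (number of lattice points) per pattern.  When two moduli fail to be coprime
(never the case for the patterns of `patterns`, which are products of fifth powers of disjoint primes,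
but the definition must be total) `loopCRT` falls back to `loopBest`, so its soundness statement is the
same unconditional one (`loopCRT_sound`).  `checkCellCRT N R K test` is `checkCell` with `loopCRT` in
place of `loopBest`; `checkCellCRT_sound`, `depth_lt_of_checkCellCRT`, `depth_lt_of_checkCellCRT_gcd`,
`hits_complete_of_checkCellCRT` mirror the statements for `checkCell`.

This makes the sparse deep cells of large boxes cheap (e.g. `ω₅ ≥ 8` beyond `10¹⁵`, where the
two-moduli walk needs `> 5·10⁹` steps), while dense shallow cells remain dominated by the per-candidate
factorisations either way.  No axiom beyond `propext`, `Classical.choice`, `Quot.sound`; the compiled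
evaluations live with the consumers.  The walk is the standard one (cf. the crux-local
`Summits/ABC/ABC/Theorems/DeepRegimeABC/Negative/CensusCheckerCRT.lean` of the refuter compute seat, whose
pattern generator lacks the product-bound pruning of `patterns`).
-/

namespace Literature.NumberTheory.DiophantineGeometry.DepthCensus

/-! ## Arithmetic progressions -/

/-- `allAP x₀ L n f = f x₀ && f (x₀ + L) && … && f (x₀ + L(n-1))`. [folklore] -/
def allAP (x₀ L n : ℕ) (f : ℕ → Bool) : Bool :=
  allRange (fun t => f (x₀ + L * t)) 0 n true

/-- `allPosRes r L hi f`: `f x` for every POSITIVE `x ≤ hi` with `x % L = r` (`r < L`). [folklore] -/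
def allPosRes (r L hi : ℕ) (f : ℕ → Bool) : Bool :=
  if r = 0 then allAP L L (hi / L) f
  else if hi < r then true else allAP r L ((hi - r) / L + 1) f

/-- Specification of `allAP`. [folklore] -/
theorem allAP_spec {x₀ L n : ℕ} {f : ℕ → Bool} (h : allAP x₀ L n f = true) {t : ℕ} (ht : t < n) :
    f (x₀ + L * t) = true := by
  rw [allAP, allRange_eq_true_iff] at h
  exact h.2 t (Nat.zero_le _) (by simpa using ht)

/-- Specification of `allPosRes`. [folklore] -/
theorem allPosRes_spec {r L hi : ℕ} {f : ℕ → Bool} (hL : 0 < L) (h : allPosRes r L hi f = true)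
    {x : ℕ} (hx : x % L = r) (h0 : 0 < x) (hhi : x ≤ hi) : f x = true := by
  have hdec : r + L * (x / L) = x := by rw [← hx]; exact Nat.mod_add_div x L
  unfold allPosRes at h
  split_ifs at h with hr hlt
  · -- `r = 0`: `x = L·(x/L)` with `x/L ≥ 1`
    subst hr
    rw [Nat.zero_add] at hdec
    have hq : 1 ≤ x / L := by
      rcases Nat.eq_zero_or_pos (x / L) with hq | hq
      · rw [hq, mul_zero] at hdec
        omega
      · exact hq
    have ht : x / L - 1 < hi / L := by
      have : x / L ≤ hi / L := Nat.div_le_div_right hhi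
      omega
    have := allAP_spec h ht
    have h3 : L * (x / L - 1) + L = L * (x / L) := by
      rw [← Nat.mul_succ, Nat.succ_eq_add_one, Nat.sub_add_cancel hq]
    have hx' : L + L * (x / L - 1) = x :=
      calc L + L * (x / L - 1) = L * (x / L - 1) + L := Nat.add_comm _ _
        _ = L * (x / L) := h3
        _ = x := hdec
    rwa [hx'] at this
  · -- `hi < r ≤ x ≤ hi`: impossible
    exfalso
    have : r ≤ x := by rw [← hdec]; exact Nat.le_add_right _ _
    omega
  · have ht : x / L < (hi - r) / L + 1 := by
      have h1 : L * (x / L) ≤ hi - r := by omega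
      have h2 : x / L ≤ (hi - r) / L := (Nat.le_div_iff_mul_le hL).mpr (by rwa [mul_comm])
      omega
    have := allAP_spec h ht
    rwa [hdec] at this

/-! ## Residue bookkeeping -/

/-- If `x ≡ 0 (mod M₁)` and `x % M₂ = s % M₂` then `x % (M₁M₂)` is the Chinese-remainder class of
`(0, s)`. [folklore] -/
theorem mod_mul_eq_crt {M₁ M₂ x s : ℕ} (co : Nat.Coprime M₁ M₂) (h1 : M₁ ∣ x) (h2 : x % M₂ = s % M₂) :
    x % (M₁ * M₂) = (Nat.chineseRemainder co 0 s : ℕ) % (M₁ * M₂) := by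
  set k := Nat.chineseRemainder co 0 s with hk
  have hk1 : (k : ℕ) ≡ 0 [MOD M₁] := k.2.1
  have hk2 : (k : ℕ) ≡ s [MOD M₂] := k.2.2
  have hx1 : x ≡ 0 [MOD M₁] := Nat.modEq_zero_iff_dvd.mpr h1
  have hx2 : x ≡ s [MOD M₂] := h2
  have h : x ≡ k [MOD M₁ * M₂] :=
    (Nat.modEq_and_modEq_iff_modEq_mul co).mp ⟨hx1.trans hk1.symm, hx2.trans hk2.symm⟩
  exact h

/-- `b ≡ −a (mod M)` as a least residue: if `M ∣ a + b` (`0 < M`) then `b % M = (M − a % M) % M`.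
[folklore] -/
theorem mod_eq_neg_mod {a b M : ℕ} (hM : 0 < M) (h : M ∣ a + b) : b % M = (M - a % M) % M := by
  have ha : a % M < M := Nat.mod_lt a hM
  have h1 : (b + a % M) % M = 0 := by
    rw [Nat.add_mod, Nat.mod_mod, ← Nat.add_mod, add_comm]
    exact Nat.mod_eq_zero_of_dvd h
  have h2 : ((M - a % M) % M + a % M) % M = 0 := by
    rw [Nat.mod_add_mod, Nat.sub_add_cancel ha.le, Nat.mod_self]
  have h3 : b ≡ (M - a % M) % M [MOD M] :=
    Nat.ModEq.add_right_cancel' (a % M) (h1.trans h2.symm)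
  simpa [Nat.ModEq, Nat.mod_mod] using h3

/-! ## The CRT walk -/

/-- **The CRT lattice walk** over the solutions of `a + b = c`, `A ∣ a`, `B ∣ b`, `C ∣ c`, `0 < a`,
`0 < b`, `c ≤ N`: the member with the largest modulus is iterated, the second runs over its exact
residue class modulo the product of the other two moduli, the third is determined.  Falls back to
`loopBest` when two moduli are not coprime. [folklore] -/
def loopCRT (N A B C : ℕ) (test : ℕ → ℕ → ℕ → Bool) : Bool :=
  if hAB : Nat.Coprime A B then
    if hBC : Nat.Coprime B C then
      if hAC : Nat.Coprime A C then
        if A ≤ C ∧ B ≤ C then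
          -- iterate `c = C·k`; `a ≡ 0 (A)`, `a ≡ c (B)`; `0 < a ≤ c - 1`
          allRange (fun k => allPosRes ((Nat.chineseRemainder hAB 0 (C * k % B) : ℕ) % (A * B))
            (A * B) (C * k - 1) (fun a => test a (C * k - a) (C * k))) 1 (N / C) true
        else if B ≤ A ∧ C ≤ A then
          -- iterate `a = A·i`; `b ≡ 0 (B)`, `b ≡ -a (C)`; `0 < b ≤ N - a`
          allRange (fun i => allPosRes
            ((Nat.chineseRemainder hBC 0 ((C - A * i % C) % C) : ℕ) % (B * C))
            (B * C) (N - A * i) (fun b => test (A * i) b (A * i + b))) 1 (N / A) true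
        else
          -- iterate `b = B·j`; `a ≡ 0 (A)`, `a ≡ -b (C)`; `0 < a ≤ N - b`
          allRange (fun j => allPosRes
            ((Nat.chineseRemainder hAC 0 ((C - B * j % C) % C) : ℕ) % (A * C))
            (A * C) (N - B * j) (fun a => test a (B * j) (a + B * j))) 1 (N / B) true
      else loopBest N A B C test
    else loopBest N A B C test
  else loopBest N A B C test

/-- `loopCRT` visits every solution. [folklore] -/
theorem loopCRT_sound {N A B C : ℕ} {test : ℕ → ℕ → ℕ → Bool} (hA : 0 < A) (hB : 0 < B)
    (hC : 0 < C) (h : loopCRT N A B C test = true) {a b c : ℕ} (ha : A ∣ a) (hb : B ∣ b)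
    (hc : C ∣ c) (ha0 : 0 < a) (hb0 : 0 < b) (habc : a + b = c) (hcN : c ≤ N) :
    test a b c = true := by
  unfold loopCRT at h
  by_cases hAB : Nat.Coprime A B
  · rw [dif_pos hAB] at h
    by_cases hBC : Nat.Coprime B C
    · rw [dif_pos hBC] at h
      by_cases hAC : Nat.Coprime A C
      · rw [dif_pos hAC] at h
        split_ifs at h with h₁ h₂
        · -- iterate `c`
          obtain ⟨k, rfl⟩ := hc
          rw [allRange_eq_true_iff] at h
          have hk : 1 ≤ k := Nat.pos_of_ne_zero (by rintro rfl; simp at habc; omega)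
          have hkN : k < 1 + N / C := by
            have : k ≤ N / C := (Nat.le_div_iff_mul_le hC).mpr (by nlinarith)
            omega
          have hin := h.2 k hk hkN
          have hres : a % (A * B) = (Nat.chineseRemainder hAB 0 (C * k % B) : ℕ) % (A * B) := by
            refine mod_mul_eq_crt hAB ha ?_
            rw [Nat.mod_mod]
            -- `a ≡ c (mod B)` since `B ∣ b = c - a`
            obtain ⟨j, rfl⟩ := hb
            have : C * k = a + B * j := habc.symm
            rw [this, Nat.add_mul_mod_self_left]
          have hf := allPosRes_spec (Nat.mul_pos hA hB) hin hres ha0 (by omega)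
          have hb' : b = C * k - a := by omega
          subst hb'
          simpa using hf
        · -- iterate `a`
          obtain ⟨i, rfl⟩ := ha
          rw [allRange_eq_true_iff] at h
          have hi : 1 ≤ i := Nat.pos_of_ne_zero (by rintro rfl; simp at ha0)
          have hiN : i < 1 + N / A := by
            have : i ≤ N / A := (Nat.le_div_iff_mul_le hA).mpr (by nlinarith)
            omega
          have hin := h.2 i hi hiN
          have hres : b % (B * C) =
              (Nat.chineseRemainder hBC 0 ((C - A * i % C) % C) : ℕ) % (B * C) := by
            refine mod_mul_eq_crt hBC hb ?_
            rw [Nat.mod_mod]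
            exact mod_eq_neg_mod hC (habc ▸ hc)
          have hf := allPosRes_spec (Nat.mul_pos hB hC) hin hres hb0 (by omega)
          subst habc
          simpa using hf
        · -- iterate `b`
          obtain ⟨j, rfl⟩ := hb
          rw [allRange_eq_true_iff] at h
          have hj : 1 ≤ j := Nat.pos_of_ne_zero (by rintro rfl; simp at hb0)
          have hjN : j < 1 + N / B := by
            have : j ≤ N / B := (Nat.le_div_iff_mul_le hB).mpr (by nlinarith)
            omega
          have hin := h.2 j hj hjN
          have hres : a % (A * C) =
              (Nat.chineseRemainder hAC 0 ((C - B * j % C) % C) : ℕ) % (A * C) := by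
            refine mod_mul_eq_crt hAC ha ?_
            rw [Nat.mod_mod]
            exact mod_eq_neg_mod hC (by rw [add_comm]; exact habc ▸ hc)
          have hf := allPosRes_spec (Nat.mul_pos hA hC) hin hres ha0 (by omega)
          subst habc
          simpa using hf
      · rw [dif_neg hAC] at h
        exact loopBest_sound hA hB hC h ha hb hc ha0 hb0 habc hcN
    · rw [dif_neg hBC] at h
      exact loopBest_sound hA hB hC h ha hb hc ha0 hb0 habc hcN
  · rw [dif_neg hAB] at h
    exact loopBest_sound hA hB hC h ha hb hc ha0 hb0 habc hcN

/-! ## The CRT cell checker -/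

/-- **The cell checker with the CRT walk**: `test` holds on every candidate of every depth pattern of
`K` primes from `deepPrimes N R` in the box `c ≤ N`. [folklore] -/
def checkCellCRT (N R K : ℕ) (test : ℕ → ℕ → ℕ → Bool) : Bool :=
  (patterns N (deepPrimes N R) K 1 1 1).all (fun t => loopCRT N t.1 t.2.1 t.2.2 test)

/-- **Soundness of `checkCellCRT`.** If `N < (R+1)⁵` and the checker accepts, then `test` holds on every
abc triple with `c ≤ N` and `ω₅(abc) ≥ K`.  (Same proof as `checkCell_sound`, with `loopCRT_sound`.)
[folklore] -/
theorem checkCellCRT_sound {N R K : ℕ} {test : ℕ → ℕ → ℕ → Bool} (hR : N < (R + 1) ^ 5)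
    (h : checkCellCRT N R K test = true) {a b c : ℕ} (habc : IsABCTriple a b c) (hcN : c ≤ N)
    (hK : K ≤ ((a * b * c).primeFactors.filter (fun p => 5 ≤ (a * b * c).factorization p)).card) :
    test a b c = true := by
  obtain ⟨ha, hb, hsum, hcop⟩ := habc
  have hc : 0 < c := by omega
  have habc0 : a * b * c ≠ 0 := by positivity
  obtain ⟨S, hSsub, hScard⟩ := Finset.exists_subset_card_eq hK
  have hS : ∀ p ∈ S, p.Prime ∧ p ^ 5 ∣ a * b * c := by
    intro p hp
    have hp' := hSsub hp
    rw [Finset.mem_filter, Nat.mem_primeFactors] at hp'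
    exact ⟨hp'.1.1, (hp'.1.1.pow_dvd_iff_le_factorization habc0).mpr hp'.2⟩
  set τ : ℕ → Fin 3 := fun p => if p ^ 5 ∣ a then 0 else if p ^ 5 ∣ b then 1 else 2 with hτ
  set T : List ℕ := (deepPrimes N R).filter (· ∈ S) with hT
  have hTsub : T.Sublist (deepPrimes N R) := List.filter_sublist
  have hmemT : ∀ p, p ∈ T ↔ p ∈ S := by
    intro p
    simp only [hT, List.mem_filter, decide_eq_true_eq, mem_deepPrimes]
    constructor
    · exact fun h => h.2
    · intro hp
      obtain ⟨hpr, hdvd⟩ := hS p hp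
      have hp5 : p ^ 5 ≤ N := by
        rcases pow_dvd_or ⟨ha, hb, hsum, hcop⟩ hpr hdvd with h | h | h
        · exact (Nat.le_of_dvd ha h).trans (by omega)
        · exact (Nat.le_of_dvd hb h).trans (by omega)
        · exact (Nat.le_of_dvd hc h).trans hcN
      refine ⟨⟨?_, hpr, hp5⟩, hp⟩
      by_contra hlt
      have : (R + 1) ^ 5 ≤ p ^ 5 := Nat.pow_le_pow_left (by omega) 5
      omega
  have hTnd : T.Nodup := (deepPrimes_nodup N R).filter _
  have hTpr : ∀ p ∈ T, p.Prime := fun p hp => (hS p ((hmemT p).mp hp)).1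
  have hTlen : T.length = K := by
    rw [← List.toFinset_card_of_nodup hTnd, ← hScard]
    congr 1
    ext p
    rw [List.mem_toFinset, hmemT]
  have hτa : ∀ p, τ p = 0 → p ^ 5 ∣ a := by
    intro p hp
    by_contra hn
    simp only [hτ, hn, if_false] at hp
    split_ifs at hp <;> exact absurd hp (by decide)
  have hτb : ∀ p, τ p = 1 → p ^ 5 ∣ b := by
    intro p hp
    by_contra hn
    simp only [hτ, hn, if_false] at hp
    split_ifs at hp <;> exact absurd hp (by decide)
  have hτc : ∀ p ∈ T, τ p = 2 → p ^ 5 ∣ c := by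
    intro p hpT hp
    obtain ⟨hpr, hdvd⟩ := hS p ((hmemT p).mp hpT)
    rcases pow_dvd_or ⟨ha, hb, hsum, hcop⟩ hpr hdvd with h | h | h
    · simp [hτ, h] at hp
    · have hna : ¬ p ^ 5 ∣ a := by
        intro h'
        simp [hτ, h'] at hp
      simp [hτ, hna, h] at hp
    · exact h
  have hA : asgProd τ 0 T ∣ a := asgProd_dvd hTnd hTpr (fun p _ hp => hτa p hp)
  have hB : asgProd τ 1 T ∣ b := asgProd_dvd hTnd hTpr (fun p _ hp => hτb p hp)
  have hC : asgProd τ 2 T ∣ c := asgProd_dvd hTnd hTpr hτc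
  have hAle : 1 * asgProd τ 0 T ≤ N := by
    rw [one_mul]; exact (Nat.le_of_dvd ha hA).trans (by omega)
  have hBle : 1 * asgProd τ 1 T ≤ N := by
    rw [one_mul]; exact (Nat.le_of_dvd hb hB).trans (by omega)
  have hCle : 1 * asgProd τ 2 T ≤ N := by
    rw [one_mul]; exact (Nat.le_of_dvd hc hC).trans hcN
  have hABC : 4 * ((1 * asgProd τ 0 T) * (1 * asgProd τ 1 T) * (1 * asgProd τ 2 T)) ≤ N ^ 3 := by
    simp only [one_mul]
    calc 4 * (asgProd τ 0 T * asgProd τ 1 T * asgProd τ 2 T) ≤ 4 * (a * b * c) :=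
          Nat.mul_le_mul_left 4 (Nat.mul_le_mul (Nat.mul_le_mul (Nat.le_of_dvd ha hA)
            (Nat.le_of_dvd hb hB)) (Nat.le_of_dvd hc hC))
      _ ≤ N ^ 3 := four_mul_le_cube hsum hcN
  have hmem := mem_patterns N (deepPrimes N R) K 1 1 1 T τ hTsub hTlen (deepPrimes_sorted N R)
    (fun p hp => (mem_deepPrimes.mp hp).2.1.one_le) hAle hBle hCle hABC
  rw [checkCellCRT, List.all_eq_true] at h
  have hloop := h _ hmem
  simp only at hloop
  have h1 : ∀ d, 0 < 1 * asgProd τ d T := fun d => by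
    rw [one_mul]
    exact one_le_asgProd τ d (fun p hp => (hTpr p hp).one_le)
  have hA' : 1 * asgProd τ 0 T ∣ a := by rwa [one_mul]
  have hB' : 1 * asgProd τ 1 T ∣ b := by rwa [one_mul]
  have hC' : 1 * asgProd τ 2 T ∣ c := by rwa [one_mul]
  exact loopCRT_sound (h1 0) (h1 1) (h1 2) hloop hA' hB' hC' ha hb hsum hcN

/-- **Empty cells (CRT).** If the checker accepts the always-failing test, no abc triple with `c ≤ N`
has `ω₅(abc) ≥ K`. [folklore] -/
theorem depth_lt_of_checkCellCRT {N R K : ℕ} (hR : N < (R + 1) ^ 5)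
    (h : checkCellCRT N R K (fun _ _ _ => false) = true) {a b c : ℕ} (habc : IsABCTriple a b c)
    (hcN : c ≤ N) :
    ((a * b * c).primeFactors.filter (fun p => 5 ≤ (a * b * c).factorization p)).card < K := by
  by_contra hK
  exact Bool.false_ne_true (checkCellCRT_sound hR h habc hcN (not_lt.mp hK))

/-- **No abc triple in the cell-in-the-box (CRT)**, from the test "`gcd(a,b) ≠ 1`". [folklore] -/
theorem depth_lt_of_checkCellCRT_gcd {N R K : ℕ} (hR : N < (R + 1) ^ 5)
    (h : checkCellCRT N R K (fun a b _ => !(Nat.gcd a b == 1)) = true) {a b c : ℕ}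
    (habc : IsABCTriple a b c) (hcN : c ≤ N) :
    ((a * b * c).primeFactors.filter (fun p => 5 ≤ (a * b * c).factorization p)).card < K := by
  by_contra hK
  have hrun := checkCellCRT_sound hR h habc hcN (not_lt.mp hK)
  have hcop : Nat.gcd a b = 1 := habc.2.2.2
  simp [hcop] at hrun

/-- **Census (CRT).** If the checker accepts `hitTest L`, every abc hit of the cell `{ω₅ ≥ K}` in the box
`{c ≤ N}` is listed in `L` with its radical, in one of the two orientations. [folklore] -/
theorem hits_complete_of_checkCellCRT {N R K : ℕ} {L : List (ℕ × ℕ × ℕ × ℕ)} (hR : N < (R + 1) ^ 5)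
    (h : checkCellCRT N R K (hitTest L) = true) {a b c : ℕ} (habc : IsABCTriple a b c) (hcN : c ≤ N)
    (hK : K ≤ ((a * b * c).primeFactors.filter (fun p => 5 ≤ (a * b * c).factorization p)).card)
    (hlt : rad a b c < c) : (a, b, c, rad a b c) ∈ L ∨ (b, a, c, rad a b c) ∈ L :=
  hitTest_sound habc (checkCellCRT_sound hR h habc hcN hK) hlt

end Literature.NumberTheory.DiophantineGeometry.DepthCensus
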